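import Mathlib
import Literature.Analysis.Fourier.HilbertTransformCircle
import Literature.Analysis.Fourier.PeriodicModeCalculus
import HarnessLib

/-!
# The periodic Hilbert transform is the Fourier multiplier `−i·sgn m` on the window modes of
# Lipschitz `2π`-periodic functions

Topic `Literature/Analysis/Fourier`. Companion of `HilbertTransformCircle.lean` (the operator
`hilbertTransformCircle f x = (2π)⁻¹ ∫₀^π (f(x−t) − f(x+t)) cot(t/2) dt` and its action on single modes,
`H sin k· = −cos k·`, `H cos k· = sin k·`) and of `PeriodicModeCalculus.lean` (the un-normalised window modes
`modeCoeff T m g = ∫₀ᵀ e^{−2πimφ/T} g(φ) dφ`). Everything here is PROVED; no definitions, no named facts.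

* (private) the kernel bound `t·cot(t/2) ≤ 2` on `(0, π]` (`u ≤ tan u`) and, for a `K`-Lipschitz `f`,
  `|(f(x−t) − f(x+t)) cot(t/2)| ≤ 4K` on `(0, π]`; `intervalIntegrable_symmIntegrand`;
* `continuous_hilbertTransformCircle`, `abs_hilbertTransformCircle_le` — for `K`-Lipschitz `f`, `Hf` is
  continuous and `|Hf| ≤ 2K` (dominated parametric integral);
* `integral_sin_int_mul_cot_half` — `∫₀^π sin(mt) cot(t/2) dt = π · sgn m` for every `m ∈ ℤ` (read off the
  public `hilbertTransformCircle_sin` at `x = 0`);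
* `modeCoeff_comp_sub_const` — translation covariance of the window modes of a `T`-periodic function:
  `∫₀ᵀ e_{−m}(x) w(x − z) dx = e_{−m}(z) ∫₀ᵀ e_{−m}(y) w(y) dy`;
* **`modeCoeff_hilbertTransformCircle`** — for a `K`-Lipschitz `2π`-periodic `f` and every `m ∈ ℤ`:
  `modeCoeff 2π m (Hf) = (−i·sgn m) · modeCoeff 2π m f` — the conjugate-function operator IS the multiplier
  `−i sgn m` [cite: Grafakos2014, Ex. 4.1.4 (the conjugate function on `𝕋¹` acts as `−i sgn k` on Fourier
  coefficients); Katznelson2004, Ch. III §1 (conjugate Fourier series)] (proof: Fubini on the `cot` form —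
  the two-variable integrand is bounded by `4K/(2π)` — then translation covariance of the modes and the mode
  integral above).

## Mathlib / tree search
Tree: `hilbertTransformCircle_{sin,cos,tsum,trigPoly}` (the multiplier on explicit modes / on functions GIVEN as
trigonometric series); `ChoiEtAl2017PeriodicHouLuoHilbertL2.fourierCoeffOn_periodicHLVelocity` (the same
Fubini pattern for the log-kernel velocity operator `Q` of the Hou–Luo model — a different operator).
Not in tree/Mathlib: the multiplier statement for the `cot`-form operator on a function class (searched
`modeCoeff.*hilbert`, `fourierCoeff.*hilbertTransformCircle`, `conjugate function`).

WHAT THIS IS NOT: no `L²`/`Lᵖ` theory of the conjugate function (M. Riesz), nothing for non-Lipschitz `f`.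
-/

noncomputable section

open MeasureTheory Set Filter Real intervalIntegral Complex
open scoped Topology

namespace Literature.Analysis.Fourier

/-! ### The kernel bound -/

/-- On `(0, π]` the half-angle sine is positive. [folklore] -/
private theorem sin_half_pos_of_mem_Ioc {t : ℝ} (ht : t ∈ Ioc (0 : ℝ) π) : 0 < Real.sin (t / 2) :=
  Real.sin_pos_of_pos_of_lt_pi (by linarith [ht.1]) (by linarith [ht.2, Real.pi_pos])

/-- On `(0, π]` the kernel `cot(t/2)` is nonnegative. [folklore] -/
private theorem cot_half_nonneg_of_mem_Ioc {t : ℝ} (ht : t ∈ Ioc (0 : ℝ) π) :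
    0 ≤ Real.cos (t / 2) / Real.sin (t / 2) :=
  div_nonneg (Real.cos_nonneg_of_mem_Icc ⟨by linarith [ht.1, Real.pi_pos], by linarith [ht.2]⟩)
    (sin_half_pos_of_mem_Ioc ht).le

/-- **The kernel bound** `t · cot(t/2) ≤ 2` on `(0, π]` (equivalently `u cos u ≤ sin u` on `(0, π/2]`, i.e.
`u ≤ tan u`). [folklore] -/
private theorem mul_cot_half_le_two {t : ℝ} (ht : t ∈ Ioc (0 : ℝ) π) :
    t * (Real.cos (t / 2) / Real.sin (t / 2)) ≤ 2 := by
  have hs : 0 < Real.sin (t / 2) := sin_half_pos_of_mem_Ioc ht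
  rw [mul_div_assoc', div_le_iff₀ hs]
  have hu0 : 0 < t / 2 := by linarith [ht.1]
  have hu1 : t / 2 ≤ π / 2 := by linarith [ht.2]
  have key : t / 2 * Real.cos (t / 2) ≤ Real.sin (t / 2) := by
    rcases lt_or_eq_of_le hu1 with h | h
    · have hc : 0 < Real.cos (t / 2) := Real.cos_pos_of_mem_Ioo ⟨by linarith, h⟩
      have htan : t / 2 < Real.tan (t / 2) := Real.lt_tan hu0 h
      rw [Real.tan_eq_sin_div_cos, lt_div_iff₀ hc] at htan
      exact htan.le
    · rw [h, Real.cos_pi_div_two, Real.sin_pi_div_two]; norm_num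
  calc t * Real.cos (t / 2) = 2 * (t / 2 * Real.cos (t / 2)) := by ring
    _ ≤ 2 * Real.sin (t / 2) := by gcongr

/-! ### The symmetric integrand of a Lipschitz function -/

/-- For a `K`-Lipschitz `f` and `t ∈ (0, π]`: `|(f(x−t) − f(x+t)) · cot(t/2)| ≤ 4K`. [folklore] -/
private theorem abs_symmIntegrand_le {f : ℝ → ℝ} {K : NNReal} (hf : LipschitzWith K f) (x : ℝ) {t : ℝ}
    (ht : t ∈ Ioc (0 : ℝ) π) :
    |(f (x - t) - f (x + t)) * (Real.cos (t / 2) / Real.sin (t / 2))| ≤ 4 * K := by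
  have hcot := cot_half_nonneg_of_mem_Ioc ht
  have hdiff : |f (x - t) - f (x + t)| ≤ K * (2 * t) := by
    have h := hf.dist_le_mul (x - t) (x + t)
    rw [Real.dist_eq, Real.dist_eq, show x - t - (x + t) = -(2 * t) by ring, abs_neg,
      abs_of_pos (by linarith [ht.1] : (0:ℝ) < 2 * t)] at h
    exact h
  rw [abs_mul, abs_of_nonneg hcot]
  calc |f (x - t) - f (x + t)| * (Real.cos (t / 2) / Real.sin (t / 2))
      ≤ K * (2 * t) * (Real.cos (t / 2) / Real.sin (t / 2)) := by gcongr
    _ = 2 * K * (t * (Real.cos (t / 2) / Real.sin (t / 2))) := by ring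
    _ ≤ 2 * K * 2 := by gcongr; exact mul_cot_half_le_two ht
    _ = 4 * K := by ring

/-- The kernel `t ↦ cot(t/2)` is measurable. [folklore] -/
private theorem measurable_cot_half : Measurable fun t : ℝ => Real.cos (t / 2) / Real.sin (t / 2) :=
  (Real.continuous_cos.measurable.comp (measurable_id.div_const 2)).div
    (Real.continuous_sin.measurable.comp (measurable_id.div_const 2))

/-- The symmetric integrand is measurable in `t` (for continuous `f`). [folklore] -/
private theorem measurable_symmIntegrand {f : ℝ → ℝ} (hf : Continuous f) (x : ℝ) :
    Measurable fun t : ℝ => (f (x - t) - f (x + t)) * (Real.cos (t / 2) / Real.sin (t / 2)) := by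
  have h1 : Measurable fun t : ℝ => f (x - t) - f (x + t) := by fun_prop
  exact h1.mul measurable_cot_half

/-- For a `K`-Lipschitz `f`, the symmetric integrand of `Hf` is interval-integrable on `[0, π]` at every `x`
(bounded by `4K`, measurable) — the conjugate-function integral converges absolutely on Lipschitz functions.
[cite: Grafakos2014, Ex. 4.1.4 (conjugate function on `𝕋¹`); Katznelson2004, Ch. III §1] -/
theorem intervalIntegrable_symmIntegrand {f : ℝ → ℝ} {K : NNReal} (hf : LipschitzWith K f) (x : ℝ) :
    IntervalIntegrable (fun t => (f (x - t) - f (x + t)) * (Real.cos (t / 2) / Real.sin (t / 2)))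
      volume 0 π := by
  rw [intervalIntegrable_iff_integrableOn_Ioc_of_le Real.pi_pos.le]
  refine Measure.integrableOn_of_bounded (M := 4 * K) measure_Ioc_lt_top.ne
    (measurable_symmIntegrand hf.continuous x).aestronglyMeasurable ?_
  rw [ae_restrict_iff' measurableSet_Ioc]
  exact ae_of_all _ fun t ht => by rw [Real.norm_eq_abs]; exact abs_symmIntegrand_le hf x ht

/-! ### Continuity and boundedness of `Hf` for Lipschitz `f` -/

/-- **`Hf` is continuous** for a `K`-Lipschitz `f` (parametric integral dominated by the constant `4K`).
[cite: Grafakos2014, Ex. 4.1.4 (conjugate function on `𝕋¹`); Katznelson2004, Ch. III §1] -/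
theorem continuous_hilbertTransformCircle {f : ℝ → ℝ} {K : NNReal} (hf : LipschitzWith K f) :
    Continuous (hilbertTransformCircle f) := by
  have hc := hf.continuous
  unfold hilbertTransformCircle
  refine continuous_const.mul ?_
  refine intervalIntegral.continuous_of_dominated_interval (bound := fun _ => 4 * (K : ℝ)) ?_ ?_
    intervalIntegrable_const ?_
  · exact fun x => (measurable_symmIntegrand hc x).aestronglyMeasurable
  · intro x
    rw [uIoc_of_le Real.pi_pos.le]
    exact ae_of_all _ fun t ht => by rw [Real.norm_eq_abs]; exact abs_symmIntegrand_le hf x ht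
  · refine ae_of_all _ fun t _ => ?_
    fun_prop

/-- **`|Hf(x)| ≤ 2K`** for a `K`-Lipschitz `f` (`(2π)⁻¹ · 4K · π`).
[cite: Grafakos2014, Ex. 4.1.4 (conjugate function on `𝕋¹`); Katznelson2004, Ch. III §1] -/
theorem abs_hilbertTransformCircle_le {f : ℝ → ℝ} {K : NNReal} (hf : LipschitzWith K f) (x : ℝ) :
    |hilbertTransformCircle f x| ≤ 2 * K := by
  unfold hilbertTransformCircle
  have hint : ‖∫ t in (0:ℝ)..π, (f (x - t) - f (x + t)) * (Real.cos (t / 2) / Real.sin (t / 2))‖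
      ≤ 4 * K * |π - 0| := by
    refine intervalIntegral.norm_integral_le_of_norm_le_const fun t ht => ?_
    rw [uIoc_of_le Real.pi_pos.le] at ht
    rw [Real.norm_eq_abs]
    exact abs_symmIntegrand_le hf x ht
  rw [sub_zero, abs_of_pos Real.pi_pos, Real.norm_eq_abs] at hint
  rw [abs_mul, abs_of_pos (by positivity : (0:ℝ) < (2 * π)⁻¹)]
  calc (2 * π)⁻¹ * |∫ t in (0:ℝ)..π, (f (x - t) - f (x + t)) * (Real.cos (t / 2) / Real.sin (t / 2))|
      ≤ (2 * π)⁻¹ * (4 * K * π) := by gcongr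
    _ = 2 * K := by field_simp; ring

/-! ### The mode integral `∫₀^π sin(mt) cot(t/2) dt = π · sgn m` -/

/-- `∫₀^π sin(kt) cot(t/2) dt = π` for natural `k ≥ 1`, with the interval-integrability — read off the public
`hilbertTransformCircle_sin` (`H[sin k·](0) = −cos 0 = −1`, whose defining integral is `−(1/π)·` this one).
[cite: Grafakos2014, Ex. 4.1.4(c)] -/
theorem integral_sin_nat_mul_cot_half (k : ℕ) (hk : 1 ≤ k) :
    IntervalIntegrable (fun t => Real.sin ((k : ℝ) * t) * (Real.cos (t / 2) / Real.sin (t / 2))) volume 0 π ∧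
      ∫ t in (0 : ℝ)..π, Real.sin ((k : ℝ) * t) * (Real.cos (t / 2) / Real.sin (t / 2)) = π := by
  -- the symmetric integrand of `sin(k·)` at `x = 0` is `−2 ·` ours
  have hpt : ∀ t : ℝ, (Real.sin ((k : ℝ) * (0 - t)) - Real.sin ((k : ℝ) * (0 + t)))
      * (Real.cos (t / 2) / Real.sin (t / 2))
      = (-2) * (Real.sin ((k : ℝ) * t) * (Real.cos (t / 2) / Real.sin (t / 2))) := by
    intro t
    rw [zero_sub, zero_add, mul_neg, Real.sin_neg]
    ring
  have hii := intervalIntegrable_hilbertCircle_sin k hk 0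
  have hii' : IntervalIntegrable
      (fun t => Real.sin ((k : ℝ) * t) * (Real.cos (t / 2) / Real.sin (t / 2))) volume 0 π := by
    have h := hii.const_mul (-2)⁻¹
    refine h.congr_ae (Eventually.of_forall fun t => ?_)
    simp only [hpt t]
    ring
  refine ⟨hii', ?_⟩
  have hH := hilbertTransformCircle_sin k hk 0
  unfold hilbertTransformCircle at hH
  simp_rw [hpt] at hH
  rw [intervalIntegral.integral_const_mul, mul_zero, Real.cos_zero] at hH
  set J := ∫ t in (0 : ℝ)..π, Real.sin ((k : ℝ) * t) * (Real.cos (t / 2) / Real.sin (t / 2)) with hJ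
  have hπ : (π : ℝ) ≠ 0 := Real.pi_ne_zero
  have h1 : (2 * π)⁻¹ * (-2 * J) = -(J / π) := by field_simp
  rw [h1] at hH
  have h2 : J / π = 1 := by linarith
  rw [div_eq_one_iff_eq hπ] at h2
  exact h2

/-- **`∫₀^π sin(mt) cot(t/2) dt = π · sgn m` for every integer `m`** (odd in `m`; `0` at `m = 0`), with the
interval-integrability. [cite: Grafakos2014, Ex. 4.1.4(c)] -/
theorem integral_sin_int_mul_cot_half (m : ℤ) :
    IntervalIntegrable (fun t => Real.sin ((m : ℝ) * t) * (Real.cos (t / 2) / Real.sin (t / 2))) volume 0 π ∧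
      ∫ t in (0 : ℝ)..π, Real.sin ((m : ℝ) * t) * (Real.cos (t / 2) / Real.sin (t / 2)) = π * (Int.sign m) := by
  rcases lt_trichotomy m 0 with hm | hm | hm
  · -- `m = −k`, `k ≥ 1`
    obtain ⟨k, hk⟩ : ∃ k : ℕ, (m : ℤ) = -(k : ℤ) := ⟨m.natAbs, by omega⟩
    have hk1 : 1 ≤ k := by omega
    have hcast : (m : ℝ) = -(k : ℝ) := by exact_mod_cast hk
    have hpt : ∀ t : ℝ, Real.sin ((m : ℝ) * t) * (Real.cos (t / 2) / Real.sin (t / 2))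
        = (-1) * (Real.sin ((k : ℝ) * t) * (Real.cos (t / 2) / Real.sin (t / 2))) := by
      intro t; rw [hcast, neg_mul, Real.sin_neg]; ring
    obtain ⟨hi, hv⟩ := integral_sin_nat_mul_cot_half k hk1
    simp_rw [hpt]
    refine ⟨hi.const_mul (-1), ?_⟩
    rw [intervalIntegral.integral_const_mul, hv, Int.sign_eq_neg_one_of_neg hm]
    push_cast
    ring
  · subst hm
    simp
  · obtain ⟨k, hk⟩ : ∃ k : ℕ, (m : ℤ) = (k : ℤ) := ⟨m.natAbs, by omega⟩
    have hk1 : 1 ≤ k := by omega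
    have hcast : (m : ℝ) = (k : ℝ) := by exact_mod_cast hk
    obtain ⟨hi, hv⟩ := integral_sin_nat_mul_cot_half k hk1
    simp_rw [hcast]
    refine ⟨hi, ?_⟩
    rw [hv, Int.sign_eq_one_of_pos hm]
    push_cast
    ring

/-! ### Window modes: the character and translation covariance -/

/-- The character of the window modes, unfolded: `fourier (−m) (x : AddCircle T) = exp(−2πimx/T)`. [folklore] -/
private theorem fourier_neg_coe_eq_exp (T : ℝ) (m : ℤ) (x : ℝ) :
    fourier (-m) (x : AddCircle T) = Complex.exp (-(2 * π * I * m * x / T)) := by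
  rw [fourier_coe_apply]
  congr 1
  push_cast
  ring

/-- The character has modulus one. [folklore] -/
private theorem norm_fourier_neg_coe (T : ℝ) (m : ℤ) (x : ℝ) : ‖fourier (-m) (x : AddCircle T)‖ = 1 := by
  rw [fourier_neg_coe_eq_exp, show -(2 * π * I * m * x / T) = ((-(2 * π * m * x / T) : ℝ) : ℂ) * I by
    push_cast; ring, Complex.norm_exp_ofReal_mul_I]

/-- Multiplicativity of the character in the space variable: `e_{−m}(y + z) = e_{−m}(y) · e_{−m}(z)`. [folklore] -/
private theorem fourier_neg_coe_add (T : ℝ) (m : ℤ) (y z : ℝ) :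
    fourier (-m) ((y + z : ℝ) : AddCircle T) = fourier (-m) (y : AddCircle T) * fourier (-m) (z : AddCircle T) := by
  rw [fourier_neg_coe_eq_exp, fourier_neg_coe_eq_exp, fourier_neg_coe_eq_exp, ← Complex.exp_add]
  congr 1
  push_cast
  ring

/-- Periodicity of the character: `e_{−m}(x + T) = e_{−m}(x)`. [folklore] -/
private theorem fourier_neg_coe_add_period (T : ℝ) (m : ℤ) (x : ℝ) :
    fourier (-m) ((x + T : ℝ) : AddCircle T) = fourier (-m) (x : AddCircle T) := by
  rw [AddCircle.coe_add_period]

/-- **Translation covariance of the window modes.** For a `T`-periodic `w : ℝ → ℂ` and every `z`,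
`∫₀ᵀ e_{−m}(x) w(x − z) dx = e_{−m}(z) · ∫₀ᵀ e_{−m}(y) w(y) dy` (substitute `x = y + z`; the integrand
`e_{−m} · w` is `T`-periodic, so the window may be shifted back): the Fourier coefficients of the translate
`w(· − z)` are `e^{−2πimz/T} ŵ(m)`. [cite: Katznelson2004, Ch. I §1.4 (Fourier coefficients of translates)] -/
theorem modeCoeff_comp_sub_const {T : ℝ} {w : ℝ → ℂ} (hper : Function.Periodic w T) (m : ℤ) (z : ℝ) :
    modeCoeff T m (fun x => w (x - z)) = fourier (-m) (z : AddCircle T) * modeCoeff T m w := by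
  unfold modeCoeff
  set G : ℝ → ℂ := fun y => fourier (-m) ((y + z : ℝ) : AddCircle T) * w y with hG
  have hGper : Function.Periodic G T := by
    intro y
    simp only [hG]
    rw [hper y, show y + T + z = (y + z) + T by ring, fourier_neg_coe_add_period]
  have h1 : (∫ x in (0 : ℝ)..T, fourier (-m) (x : AddCircle T) * w (x - z)) = ∫ x in (0 : ℝ)..T, G (x - z) := by
    refine intervalIntegral.integral_congr fun x _ => ?_
    simp only [hG, sub_add_cancel]
  rw [h1, intervalIntegral.integral_comp_sub_right G z, zero_sub]
  have h2 := hGper.intervalIntegral_add_eq (-z) 0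
  rw [zero_add, show -z + T = T - z by ring] at h2
  rw [h2]
  have h3 : (∫ y in (0 : ℝ)..T, G y) =
      ∫ y in (0 : ℝ)..T, fourier (-m) (z : AddCircle T) * (fourier (-m) (y : AddCircle T) * w y) := by
    refine intervalIntegral.integral_congr fun y _ => ?_
    simp only [hG]
    rw [fourier_neg_coe_add]
    ring
  rw [h3, intervalIntegral.integral_const_mul]

/-- Translation covariance, `x + z` form: `∫₀ᵀ e_{−m}(x) w(x + z) dx = e_{−m}(−z) · ∫₀ᵀ e_{−m}(y) w(y) dy`.
[cite: Katznelson2004, Ch. I §1.4 (Fourier coefficients of translates)] -/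
theorem modeCoeff_comp_add_const {T : ℝ} {w : ℝ → ℂ} (hper : Function.Periodic w T) (m : ℤ) (z : ℝ) :
    modeCoeff T m (fun x => w (x + z)) = fourier (-m) ((-z : ℝ) : AddCircle T) * modeCoeff T m w := by
  have h := modeCoeff_comp_sub_const hper m (-z)
  simp only [sub_neg_eq_add] at h
  exact h

/-- The difference of the two characters is a sine: `e_{−m}(t) − e_{−m}(−t) = −2i sin(mt)` on the circle of
length `2π`. [folklore] -/
private theorem fourier_neg_coe_sub_fourier_neg_coe_neg (m : ℤ) (t : ℝ) :
    fourier (-m) (t : AddCircle (2 * π)) - fourier (-m) ((-t : ℝ) : AddCircle (2 * π))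
      = -2 * I * ((Real.sin ((m : ℝ) * t) : ℝ) : ℂ) := by
  rw [fourier_neg_coe_eq_exp, fourier_neg_coe_eq_exp, Complex.ofReal_sin]
  have hπ : (π : ℂ) ≠ 0 := by exact_mod_cast Real.pi_ne_zero
  set z : ℂ := (((m : ℝ) * t : ℝ) : ℂ) with hz
  have e1 : -(2 * π * I * m * (t : ℝ) / ((2 * π : ℝ) : ℂ)) = -z * I := by
    rw [hz]; push_cast; field_simp
  have e2 : -(2 * π * I * m * ((-t : ℝ) : ℂ) / ((2 * π : ℝ) : ℂ)) = z * I := by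
    rw [hz]; push_cast; field_simp
  rw [e1, e2, Complex.sin]
  linear_combination (Complex.exp (-z * I) - Complex.exp (z * I)) * Complex.I_sq

/-! ### The multiplier theorem -/

/-- A continuous periodic real function, seen in `ℂ`, is interval-integrable against the character. [folklore] -/
private theorem intervalIntegrable_fourier_mul_ofReal {T : ℝ} {g : ℝ → ℝ} (hg : Continuous g) (m : ℤ) (a b : ℝ) :
    IntervalIntegrable (fun x => fourier (-m) (x : AddCircle T) * ((g x : ℝ) : ℂ)) volume a b := by
  have hc : Continuous fun x : ℝ => fourier (-m) (x : AddCircle T) :=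
    (map_continuous (fourier (-m))).comp (AddCircle.continuous_mk' T)
  exact (hc.mul (Complex.continuous_ofReal.comp hg)).intervalIntegrable _ _

/-- **The periodic Hilbert transform is the Fourier multiplier `−i·sgn m`.** For a `K`-Lipschitz `2π`-periodic
`f : ℝ → ℝ` and every `m ∈ ℤ`, the window mode of `Hf = hilbertTransformCircle f` is
`modeCoeff 2π m (Hf) = (−i · sgn m) · modeCoeff 2π m f`, i.e. `(Hf)^(m) = −i sgn(m) f̂(m)`.
Proof: write the mode of `Hf` as the double integral of `F(x,t) = e_{−m}(x)(2π)⁻¹(f(x−t) − f(x+t))cot(t/2)` over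
`(0,2π] × (0,π]` (integrand bounded by `4K/(2π)`: Fubini), evaluate the inner `x`-integral by translation
covariance (`(e_{−m}(t) − e_{−m}(−t)) · f̂ = −2i sin(mt) · f̂`), and use `∫₀^π sin(mt)cot(t/2) dt = π sgn m`.
[cite: Grafakos2014, Ex. 4.1.4 (the conjugate function acts as `−i sgn k` on Fourier coefficients);
Katznelson2004, Ch. III §1] -/
theorem modeCoeff_hilbertTransformCircle {f : ℝ → ℝ} {K : NNReal} (hf : LipschitzWith K f)
    (hper : Function.Periodic f (2 * π)) (m : ℤ) :
    modeCoeff (2 * π) m (fun x => ((hilbertTransformCircle f x : ℝ) : ℂ))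
      = (-I * (Int.sign m : ℂ)) * modeCoeff (2 * π) m (fun x => ((f x : ℝ) : ℂ)) := by
  have hfc : Continuous f := hf.continuous
  have h2π : (0 : ℝ) < 2 * π := by positivity
  -- notation
  set e : ℝ → ℂ := fun x => fourier (-m) (x : AddCircle (2 * π)) with he
  have hec : Continuous e := (map_continuous (fourier (-m))).comp (AddCircle.continuous_mk' (2 * π))
  set S : ℝ → ℝ → ℝ := fun x t => (f (x - t) - f (x + t)) * (Real.cos (t / 2) / Real.sin (t / 2)) with hS
  set C : ℂ := modeCoeff (2 * π) m (fun x => ((f x : ℝ) : ℂ)) with hC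
  -- the two-variable integrand
  set F : ℝ → ℝ → ℂ := fun x t => e x * ((((2 * π)⁻¹ : ℝ) : ℂ) * ((S x t : ℝ) : ℂ)) with hF
  -- Step 0: the mode of `Hf` as an iterated integral
  have hstep0 : modeCoeff (2 * π) m (fun x => ((hilbertTransformCircle f x : ℝ) : ℂ))
      = ∫ x in (0 : ℝ)..2 * π, ∫ t in (0 : ℝ)..π, F x t := by
    unfold modeCoeff
    refine intervalIntegral.integral_congr fun x _ => ?_
    simp only [hF, he, hS, hilbertTransformCircle]
    rw [Complex.ofReal_mul, ← intervalIntegral.integral_ofReal, ← intervalIntegral.integral_const_mul,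
      ← intervalIntegral.integral_const_mul]
  -- Step 1: Fubini
  have hFm : Measurable (Function.uncurry F) := by
    have h1 : Measurable fun p : ℝ × ℝ => e p.1 := hec.measurable.comp measurable_fst
    have h2 : Measurable fun p : ℝ × ℝ => S p.1 p.2 := by
      have ha : Measurable fun p : ℝ × ℝ => f (p.1 - p.2) - f (p.1 + p.2) := by fun_prop
      exact ha.mul (measurable_cot_half.comp measurable_snd)
    exact h1.mul (measurable_const.mul (Complex.measurable_ofReal.comp h2))
  have hFint : Integrable (Function.uncurry F)
      ((volume.restrict (Ioc 0 (2 * π))).prod (volume.restrict (Ioc 0 π))) := by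
    rw [Measure.prod_restrict]
    have hfin : (volume.prod volume) (Ioc (0:ℝ) (2 * π) ×ˢ Ioc (0:ℝ) π) ≠ ⊤ := by
      rw [Measure.prod_prod]
      exact (ENNReal.mul_lt_top measure_Ioc_lt_top measure_Ioc_lt_top).ne
    refine Measure.integrableOn_of_bounded (M := (2 * π)⁻¹ * (4 * K)) hfin hFm.aestronglyMeasurable ?_
    rw [ae_restrict_iff' (measurableSet_Ioc.prod measurableSet_Ioc)]
    refine ae_of_all _ fun p hp => ?_
    have ht : p.2 ∈ Ioc (0:ℝ) π := hp.2
    simp only [Function.uncurry, hF, he, norm_mul, norm_fourier_neg_coe, one_mul, Complex.norm_real,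
      Real.norm_eq_abs]
    rw [abs_of_pos (by positivity : (0:ℝ) < (2 * π)⁻¹)]
    gcongr
    exact abs_symmIntegrand_le hf p.1 ht
  have hswap : (∫ x in (0 : ℝ)..2 * π, ∫ t in (0 : ℝ)..π, F x t)
      = ∫ t in (0 : ℝ)..π, ∫ x in (0 : ℝ)..2 * π, F x t := by
    simp only [intervalIntegral.integral_of_le h2π.le, intervalIntegral.integral_of_le Real.pi_pos.le]
    exact MeasureTheory.integral_integral_swap hFint
  -- Step 2: the inner integral by translation covariance
  have hperC : Function.Periodic (fun x => ((f x : ℝ) : ℂ)) (2 * π) := fun x => by simp [hper x]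
  have hinner : ∀ t : ℝ, (∫ x in (0 : ℝ)..2 * π, F x t)
      = ((((2 * π)⁻¹ : ℝ) : ℂ) * ((Real.cos (t / 2) / Real.sin (t / 2) : ℝ) : ℂ))
        * ((fourier (-m) (t : AddCircle (2 * π)) - fourier (-m) ((-t : ℝ) : AddCircle (2 * π))) * C) := by
    intro t
    have hi1 : IntervalIntegrable (fun x => fourier (-m) (x : AddCircle (2 * π)) * ((f (x - t) : ℝ) : ℂ))
        volume 0 (2 * π) :=
      intervalIntegrable_fourier_mul_ofReal (g := fun x => f (x - t)) (by fun_prop) m _ _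
    have hi2 : IntervalIntegrable (fun x => fourier (-m) (x : AddCircle (2 * π)) * ((f (x + t) : ℝ) : ℂ))
        volume 0 (2 * π) :=
      intervalIntegrable_fourier_mul_ofReal (g := fun x => f (x + t)) (by fun_prop) m _ _
    have h1 : (∫ x in (0 : ℝ)..2 * π, F x t) =
        ((((2 * π)⁻¹ : ℝ) : ℂ) * ((Real.cos (t / 2) / Real.sin (t / 2) : ℝ) : ℂ))
          * ((∫ x in (0 : ℝ)..2 * π, fourier (-m) (x : AddCircle (2 * π)) * ((f (x - t) : ℝ) : ℂ))
            - ∫ x in (0 : ℝ)..2 * π, fourier (-m) (x : AddCircle (2 * π)) * ((f (x + t) : ℝ) : ℂ)) := by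
      rw [← intervalIntegral.integral_sub hi1 hi2, ← intervalIntegral.integral_const_mul]
      refine intervalIntegral.integral_congr fun x _ => ?_
      simp only [hF, hS, he]
      push_cast
      ring
    have hs := modeCoeff_comp_sub_const hperC m t
    have ha := modeCoeff_comp_add_const hperC m t
    simp only [modeCoeff] at hs ha
    rw [h1, hs, ha, hC]
    simp only [modeCoeff]
    ring
  -- Step 3: the outer integral
  rw [hstep0, hswap]
  simp_rw [hinner, fourier_neg_coe_sub_fourier_neg_coe_neg]
  obtain ⟨hi, hv⟩ := integral_sin_int_mul_cot_half m
  have h3 : (∫ t in (0 : ℝ)..π, ((((2 * π)⁻¹ : ℝ) : ℂ) * ((Real.cos (t / 2) / Real.sin (t / 2) : ℝ) : ℂ))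
      * (-2 * I * ((Real.sin ((m : ℝ) * t) : ℝ) : ℂ) * C))
      = (-(I / π)) * C * ∫ t in (0 : ℝ)..π,
          ((Real.sin ((m : ℝ) * t) * (Real.cos (t / 2) / Real.sin (t / 2)) : ℝ) : ℂ) := by
    rw [← intervalIntegral.integral_const_mul]
    refine intervalIntegral.integral_congr fun t _ => ?_
    have hπ : (π : ℂ) ≠ 0 := by exact_mod_cast Real.pi_ne_zero
    push_cast
    field_simp
  rw [h3, intervalIntegral.integral_ofReal, hv]
  have hπ : (π : ℂ) ≠ 0 := by exact_mod_cast Real.pi_ne_zero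
  push_cast
  field_simp

end Literature.Analysis.Fourier
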